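import Summits.Ventures.DiscreteObjects.Hadamard.ElemAbelianRank2_7

/-!
# Hadamard 668 census, family F12 — no `C₁₁ × C₁₁` of signed automorphisms of an H(668) (kernel)

Framing: lottery ticket; floor = certified bounds/negative ranges.

Cell pub-namedobj (venture DiscreteObjects), target (H), hadamard gen 16 (statement and first proof), gen 17 (present
proof).  **`no_hadamard668_elemAbelian_rank2_11`**: a Hadamard matrix of order `668` admits no two signed-permutation
automorphisms `(α, α', d₁, e₁)`, `(β, β', d₂, e₂)` with `α¹¹ = β¹¹ = α'¹¹ = β'¹¹ = 1`, commuting permutation parts,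
and `α, β` independent.  With `ElemAbelianSummary668` and `PrimeSquareOrder` (p268777): **`p² ∤ |Aut H(668)|` for
every prime `p ≥ 11`, entirely in the kernel.**
PROOF (gen 17, by the regular-orbit bound of `ElemAbelianRegular`; replaces gen 16's 350-line argument — Burnside +
line partition + re-signing + cycle bound + `rank2_11_arith` — which needed `maxHeartbeats 1000000` and a disabled
`constructorNameAsVariable` linter, gate note 'lint debt'; that argument survives in generalised form as
`rank2_cycle_bound` / `ElemAbelianRank2_7`).  Every `g ≠ 1` fixes `8`, `30` or `52` rows and columns (`census11`);
the 12 standard line representatives therefore fix at most `12·52 = 624 < 668` rows in total, so some row `x₁` is moved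
by every `g ≠ 1` (`rank2_exists_free`); the regular-orbit bound (`rank2_regular_bound`: the `121` distinct rows
`α^a β^b x₁` are pairwise orthogonal and agree up to row signs on every column fixed by `α'` and `β'`) gives
`121·|D'| ≤ 668`, `|D'| ≤ 5`, for the set `D'` of columns fixed by `α', β'`; but `|D'| ≡ #Fix(r) ≡ 8 (mod 11)`
(`rank2_card_fixed_mod_gen`, `census11`), so `|D'| ≥ 8`.  Ours; no `sorry`; default options.
-/

namespace Summit.Ventures.DiscreteObjects.Hadamard

open Finset BigOperators

open Literature.Combinatorics.Designs.GoethalsSeidel (IsHadamardMatrix)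

variable {ι : Type*} [Fintype ι] [DecidableEq ι]

/-- **No `C₁₁ × C₁₁` of signed automorphisms of a Hadamard matrix of order 668.** -/
theorem no_hadamard668_elemAbelian_rank2_11 {H : Matrix ι ι ℤ} (hH : IsHadamardMatrix H)
    (hι : Fintype.card ι = 668) {α α' β β' : Equiv.Perm ι} {d₁ e₁ d₂ e₂ : ι → ℤ}
    (hA : IsSignedAut H α α' d₁ e₁) (hB : IsSignedAut H β β' d₂ e₂)
    (hα : α ^ 11 = 1) (hα' : α' ^ 11 = 1) (hβ : β ^ 11 = 1) (hβ' : β' ^ 11 = 1)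
    (hc : Commute α β) (hc' : Commute α' β')
    (hind : ∀ a b : ℕ, a < 11 → b < 11 → α ^ a * β ^ b = 1 → a = 0 ∧ b = 0) : False := by
  classical
  haveI hp11 : Fact (Nat.Prime 11) := ⟨by norm_num⟩
  have hodd : Odd 11 := ⟨5, by norm_num⟩
  have hne : ∀ g : Multiplicative (ZMod 11 × ZMod 11), g ≠ 1 → (α ^ (Multiplicative.toAdd g).1.val * β ^ (Multiplicative.toAdd g).2.val) ≠ 1 :=
    fun g hg => pairPerm_ne_one 11 α β hind hg
  have hcensus : ∀ g : Multiplicative (ZMod 11 × ZMod 11), g ≠ 1 →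
      ((univ.filter fun j => (α' ^ (Multiplicative.toAdd g).1.val * β' ^ (Multiplicative.toAdd g).2.val) j = j).card = 8 ∨
        (univ.filter fun j => (α' ^ (Multiplicative.toAdd g).1.val * β' ^ (Multiplicative.toAdd g).2.val) j = j).card = 30 ∨
        (univ.filter fun j => (α' ^ (Multiplicative.toAdd g).1.val * β' ^ (Multiplicative.toAdd g).2.val) j = j).card = 52) ∧
      ((univ.filter fun i => (α ^ (Multiplicative.toAdd g).1.val * β ^ (Multiplicative.toAdd g).2.val) i = i).card = 8 ∨
        (univ.filter fun i => (α ^ (Multiplicative.toAdd g).1.val * β ^ (Multiplicative.toAdd g).2.val) i = i).card = 30 ∨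
        (univ.filter fun i => (α ^ (Multiplicative.toAdd g).1.val * β ^ (Multiplicative.toAdd g).2.val) i = i).card = 52) := by
    intro g hg
    obtain ⟨d, e, hg'⟩ := isSignedAut_pair 11 hA hB g
    exact census11 hH hι hg' (pairPerm_pow_p 11 α β hα hβ hc g) (pairPerm_pow_p 11 α' β' hα' hβ' hc' g) (hne g hg)
  -- a free row: the 12 representatives fix at most 12·52 = 624 < 668 rows
  have hN : ∀ r ∈ (insert (Multiplicative.ofAdd ((0 : ZMod 11), (1 : ZMod 11)))
        ((univ : Finset (ZMod 11)).image (fun t => Multiplicative.ofAdd ((1 : ZMod 11), t)))),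
      (univ.filter fun x => (α ^ (Multiplicative.toAdd r).1.val * β ^ (Multiplicative.toAdd r).2.val) x = x).card ≤ 52 := by
    intro r hr
    have h := (hcensus r (lineRep_ne_one 11 hr)).2
    omega
  obtain ⟨x₁, hx₁⟩ := rank2_exists_free 11 α β hα hβ hc 52 hN (by rw [hι]; norm_num)
  -- regular-orbit bound: 121·|D'| ≤ 668
  have h121 := rank2_regular_bound 11 hH hodd hA hB hα hα' hβ hβ' hc x₁ hx₁
  rw [hι] at h121
  -- |D'| ≡ 8 (mod 11)
  obtain ⟨hg1R, -, -, hg1, -, -⟩ := gens_reps 11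
  obtain ⟨-, hm⟩ := rank2_card_fixed_mod_gen 11 α' β' hα' hβ' hc' hg1R
  have hcen := (hcensus _ hg1).1
  rw [pairPerm_genA] at hcen
  rw [pairPerm_genA] at hm
  omega

end Summit.Ventures.DiscreteObjects.Hadamard
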